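import Summits.KontsevichZagierPeriods.KontsevichZagierPeriods.Theorems.XMapPeriodTransfer.Negative.ValueEqLoadBearing

/-!
# `XMapPeriodTransfer`: the lemniscate pair as genuine representations (non-vacuity of the calibration)

Negative-side support for the crux `IsogenyCertificates.XMapPeriodTransfer`
(stmt-KontsevichZagierPeriods-10665; refuter, cdisprove) and non-vacuity certificate for the route's
support item `LemniscateTwoIsogeny` (stmt-KontsevichZagierPeriods-5382). No new definitions.

* `integrableOn_inv_sqrt_cube_sub_self`: `dx/√(x³ − x)` is integrable on `{x³ − x > 0} = (−1,0) ∪ (1,∞)`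
  (`≤ (−x)^{−1/2} + (x+1)^{−1/2}` on the egg, `≤ (x−1)^{−1/2}` on `(1,2]`, `≤ 2x^{−3/2}` beyond);
* `integrableOn_inv_sqrt_cube_add_four_mul`: `dx/√(x³ + 4x)` is integrable on `(0, ∞)`;
* `exists_rep_lemniscate`, `exists_rep_four`: `[{x³−x>0}, a/√(x³−x)]` and `[{x³+4x>0}, a/√(x³+4x)]`
  are genuine `KZ.IntegralRep 1`'s in the literal shape of the crux at `(A,B) = (−1,0)`, `(4,0)`.
Used by `NaiveConstants.lean` (the transfer constant is neither `1/|c|` nor `deg/|c|`).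
Companion work file: `Cruxes/XMapPeriodTransfer/Disproof.lean`.
-/

noncomputable section

namespace Summit.KontsevichZagierPeriods.IsogenyCertificates.XMapPeriodTransferValue

open Polynomial Set MeasureTheory
open Literature.NumberTheory.Transcendental
open Summit.KontsevichZagierPeriods.KontsevichZagierPeriods.Theses.IsogenyCertificates

/-! ### Integrability for the lemniscate pair `x³ − x`, `x³ + 4x` -/

/-- `t³ + 4t > 0 ↔ t > 0`. [folklore] -/
theorem cube_add_four_mul_pos_iff (t : ℝ) : 0 < t ^ 3 + 4 * t ↔ 0 < t := by
  have h : t ^ 3 + 4 * t = t * (t ^ 2 + 4) := by ring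
  have hq : 0 < t ^ 2 + 4 := by positivity
  rw [h]
  constructor
  · intro hp; by_contra hle
    nlinarith [mul_le_mul_of_nonneg_right (not_lt.mp hle) hq.le]
  · intro ht; exact mul_pos ht hq

/-- `dt/√(t³ + 4t)` is integrable on `(0, ∞)`: `≤ t^{−1/2}` on `(0,1]`, `≤ t^{−3/2}` on `(1,∞)`. [folklore] -/
theorem integrableOn_inv_sqrt_cube_add_four_mul :
    IntegrableOn (fun t : ℝ => 1 / Real.sqrt (t ^ 3 + 4 * t)) (Ioi 0) := by
  have hmeas : Measurable fun t : ℝ => 1 / Real.sqrt (t ^ 3 + 4 * t) := by fun_prop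
  rw [← Ioc_union_Ioi_eq_Ioi (show (0 : ℝ) ≤ 1 by norm_num)]
  refine IntegrableOn.union ?_ ?_
  · have hg : IntegrableOn (fun t : ℝ => t ^ (-(1 / 2 : ℝ))) (Ioc 0 1) :=
      (intervalIntegrable_iff_integrableOn_Ioc_of_le zero_le_one).mp
        (intervalIntegral.intervalIntegrable_rpow' (by norm_num))
    refine Integrable.mono' hg hmeas.aestronglyMeasurable ?_
    filter_upwards [ae_restrict_mem measurableSet_Ioc] with t ht
    rw [Real.norm_eq_abs, abs_of_nonneg (div_nonneg zero_le_one (Real.sqrt_nonneg _))]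
    have ht0 : 0 < t := ht.1
    have hP : 0 < t ^ 3 + 4 * t := by positivity
    rw [Real.rpow_neg ht0.le, ← Real.sqrt_eq_rpow, ← one_div]
    apply one_div_le_one_div_of_le (Real.sqrt_pos.2 ht0)
    exact Real.sqrt_le_sqrt (by nlinarith [pow_pos ht0 3])
  · have hg : IntegrableOn (fun t : ℝ => t ^ (-(3 / 2) : ℝ)) (Ioi 1) :=
      integrableOn_Ioi_rpow_of_lt (by norm_num) one_pos
    refine Integrable.mono' hg hmeas.aestronglyMeasurable ?_
    filter_upwards [ae_restrict_mem measurableSet_Ioi] with t ht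
    rw [Real.norm_eq_abs, abs_of_nonneg (div_nonneg zero_le_one (Real.sqrt_nonneg _))]
    have ht0 : 0 < t := by linarith [ht.out]
    rw [Real.rpow_neg ht0.le, ← one_div]
    apply one_div_le_one_div_of_le (Real.rpow_pos_of_pos ht0 _)
    have h32 : t ^ ((3 / 2 : ℝ)) = Real.sqrt (t ^ 3) := by
      rw [Real.sqrt_eq_rpow, ← Real.rpow_natCast t 3, ← Real.rpow_mul ht0.le]; norm_num
    rw [h32]
    exact Real.sqrt_le_sqrt (by nlinarith [pow_pos ht0 3])

/-- `t³ − t > 0 ↔ t ∈ (−1, 0) ∪ (1, ∞)`. [folklore] -/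
theorem cube_sub_self_pos_iff (t : ℝ) : 0 < t ^ 3 - t ↔ t ∈ Ioo (-1 : ℝ) 0 ∪ Ioi 1 := by
  simp only [mem_union, mem_Ioo, mem_Ioi]
  have hfac : t ^ 3 - t = t * (t - 1) * (t + 1) := by ring
  constructor
  · intro h
    rcases lt_or_ge 1 t with h2 | h2
    · exact Or.inr h2
    · left
      refine ⟨?_, ?_⟩
      · by_contra h3
        have h3' : t ≤ -1 := not_lt.mp h3
        nlinarith [mul_le_mul_of_nonpos_left (show (0:ℝ) ≤ t ^ 2 - 1 by nlinarith) (show t ≤ 0 by linarith)]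
      · by_contra h3
        have h3' : 0 ≤ t := not_lt.mp h3
        nlinarith [mul_le_mul_of_nonneg_left (show t ^ 2 - 1 ≤ 0 by nlinarith) h3']
  · rintro (⟨h1, h2⟩ | h)
    · rw [hfac]; exact mul_pos (mul_pos_of_neg_of_neg h2 (by linarith)) (by linarith)
    · rw [hfac]; exact mul_pos (mul_pos (by linarith) (by linarith)) (by linarith)

/-- `1/√(u(1−u)) ≤ 1/√u + 1/√(1 − u)` on `(0,1)` (since `√u + √(1−u) ≥ u + (1−u) = 1`). [folklore] -/
theorem inv_sqrt_mul_le {u : ℝ} (h0 : 0 < u) (h1 : u < 1) :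
    1 / Real.sqrt (u * (1 - u)) ≤ 1 / Real.sqrt u + 1 / Real.sqrt (1 - u) := by
  have h1' : 0 < 1 - u := by linarith
  have hsu : 0 < Real.sqrt u := Real.sqrt_pos.2 h0
  have hs1 : 0 < Real.sqrt (1 - u) := Real.sqrt_pos.2 h1'
  have hsum : 1 ≤ Real.sqrt u + Real.sqrt (1 - u) := by
    have a1 : u ≤ Real.sqrt u := by
      conv_lhs => rw [← Real.sqrt_sq h0.le]
      exact Real.sqrt_le_sqrt (by nlinarith)
    have a2 : 1 - u ≤ Real.sqrt (1 - u) := by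
      conv_lhs => rw [← Real.sqrt_sq h1'.le]
      exact Real.sqrt_le_sqrt (by nlinarith)
    linarith
  rw [Real.sqrt_mul h0.le, div_add_div _ _ hsu.ne' hs1.ne', one_mul, mul_one,
    div_le_div_iff₀ (mul_pos hsu hs1) (mul_pos hsu hs1), one_mul]
  calc Real.sqrt u * Real.sqrt (1 - u) = 1 * (Real.sqrt u * Real.sqrt (1 - u)) := by ring
    _ ≤ (Real.sqrt (1 - u) + Real.sqrt u) * (Real.sqrt u * Real.sqrt (1 - u)) :=
        mul_le_mul_of_nonneg_right (by linarith) (mul_pos hsu hs1).le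

/-- `dt/√(t³ − t)` is integrable on `{t³ − t > 0} = (−1,0) ∪ (1,∞)`: on `(−1,0)` it is
`≤ (−t)^{−1/2} + (t+1)^{−1/2}`, on `(1,2]` `≤ (t−1)^{−1/2}`, on `(2,∞)` `≤ 2t^{−3/2}`. [folklore] -/
theorem integrableOn_inv_sqrt_cube_sub_self :
    IntegrableOn (fun t : ℝ => 1 / Real.sqrt (t ^ 3 - t)) (Ioo (-1 : ℝ) 0 ∪ Ioi 1) := by
  have hmeas : Measurable fun t : ℝ => 1 / Real.sqrt (t ^ 3 - t) := by fun_prop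
  have hr : IntervalIntegrable (fun x : ℝ => x ^ (-(1 / 2 : ℝ))) volume 0 1 :=
    intervalIntegral.intervalIntegrable_rpow' (by norm_num)
  refine IntegrableOn.union ?_ ?_
  · -- the bounded sheet `(−1, 0)`
    have hg1 : IntegrableOn (fun t : ℝ => (-t) ^ (-(1 / 2 : ℝ))) (Ioo (-1 : ℝ) 0) := by
      have h2 := (hr.comp_mul_left (c := -1)).symm
      have h3 : IntervalIntegrable (fun x : ℝ => (-x) ^ (-(1 / 2 : ℝ))) volume (-1) 0 := by
        convert h2 using 2 <;> norm_num
      exact ((intervalIntegrable_iff_integrableOn_Ioo_of_le (by norm_num : (-1 : ℝ) ≤ 0)).mp h3)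
    have hg2 : IntegrableOn (fun t : ℝ => (t + 1) ^ (-(1 / 2 : ℝ))) (Ioo (-1 : ℝ) 0) := by
      have h2 := hr.comp_add_right 1
      have h3 : IntervalIntegrable (fun x : ℝ => (x + 1) ^ (-(1 / 2 : ℝ))) volume (-1) 0 := by
        convert h2 using 2 <;> norm_num
      exact ((intervalIntegrable_iff_integrableOn_Ioo_of_le (by norm_num : (-1 : ℝ) ≤ 0)).mp h3)
    refine Integrable.mono' (hg1.add hg2) hmeas.aestronglyMeasurable ?_
    filter_upwards [ae_restrict_mem measurableSet_Ioo] with t ht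
    rw [Real.norm_eq_abs, abs_of_nonneg (div_nonneg zero_le_one (Real.sqrt_nonneg _)), Pi.add_apply]
    have hu0 : 0 < -t := by linarith [ht.2]
    have hu1 : -t < 1 := by linarith [ht.1]
    have ht1 : 0 < t + 1 := by linarith [ht.1]
    rw [Real.rpow_neg hu0.le, Real.rpow_neg ht1.le, ← Real.sqrt_eq_rpow, ← Real.sqrt_eq_rpow,
      ← one_div, ← one_div]
    have hP : (-t) * (1 - (-t)) ≤ t ^ 3 - t := by nlinarith [mul_nonneg (sq_nonneg t) ht1.le]
    have hPpos : 0 < (-t) * (1 - (-t)) := mul_pos hu0 (by linarith)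
    calc 1 / Real.sqrt (t ^ 3 - t) ≤ 1 / Real.sqrt ((-t) * (1 - (-t))) :=
          one_div_le_one_div_of_le (Real.sqrt_pos.2 hPpos) (Real.sqrt_le_sqrt hP)
      _ ≤ 1 / Real.sqrt (-t) + 1 / Real.sqrt (1 - (-t)) := inv_sqrt_mul_le hu0 hu1
      _ = 1 / Real.sqrt (-t) + 1 / Real.sqrt (t + 1) := by ring_nf
  · -- the unbounded sheet `(1, ∞) = (1, 2] ∪ (2, ∞)`
    rw [← Ioc_union_Ioi_eq_Ioi (show (1 : ℝ) ≤ 2 by norm_num)]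
    refine IntegrableOn.union ?_ ?_
    · have hg : IntegrableOn (fun t : ℝ => (t + (-1)) ^ (-(1 / 2 : ℝ))) (Ioc (1 : ℝ) 2) := by
        have h2 := hr.comp_add_right (-1)
        have h3 : IntervalIntegrable (fun x : ℝ => (x + (-1)) ^ (-(1 / 2 : ℝ))) volume 1 2 := by
          convert h2 using 2 <;> norm_num
        exact ((intervalIntegrable_iff_integrableOn_Ioc_of_le (by norm_num : (1 : ℝ) ≤ 2)).mp h3)
      refine Integrable.mono' hg hmeas.aestronglyMeasurable ?_
      filter_upwards [ae_restrict_mem measurableSet_Ioc] with t ht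
      rw [Real.norm_eq_abs, abs_of_nonneg (div_nonneg zero_le_one (Real.sqrt_nonneg _))]
      have ht1 : 0 < t + (-1) := by linarith [ht.1]
      rw [Real.rpow_neg ht1.le, ← Real.sqrt_eq_rpow, ← one_div]
      apply one_div_le_one_div_of_le (Real.sqrt_pos.2 ht1)
      have hkey : 0 ≤ (t + (-1)) * (t ^ 2 + t - 1) := mul_nonneg ht1.le (by nlinarith [ht.1])
      exact Real.sqrt_le_sqrt (by nlinarith [hkey])
    · have hg : IntegrableOn (fun t : ℝ => 2 * t ^ (-(3 / 2) : ℝ)) (Ioi 2) :=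
        (integrableOn_Ioi_rpow_of_lt (by norm_num) two_pos).const_mul 2
      refine Integrable.mono' hg hmeas.aestronglyMeasurable ?_
      filter_upwards [ae_restrict_mem measurableSet_Ioi] with t ht
      rw [Real.norm_eq_abs, abs_of_nonneg (div_nonneg zero_le_one (Real.sqrt_nonneg _))]
      have ht2 : 2 < t := ht.out
      have ht0 : 0 < t := by linarith
      have h32 : t ^ ((3 / 2 : ℝ)) = Real.sqrt (t ^ 3) := by
        rw [Real.sqrt_eq_rpow, ← Real.rpow_natCast t 3, ← Real.rpow_mul ht0.le]; norm_num
      have hprod : 0 < t * (t ^ 2 - 4) := mul_pos ht0 (by nlinarith)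
      rw [Real.rpow_neg ht0.le, h32, ← div_eq_mul_inv,
        div_le_div_iff₀ (Real.sqrt_pos.2 (by nlinarith)) (Real.sqrt_pos.2 (by positivity)), one_mul]
      have h4 : Real.sqrt 4 = 2 := by
        rw [show (4 : ℝ) = 2 ^ 2 by norm_num, Real.sqrt_sq (by norm_num)]
      calc Real.sqrt (t ^ 3) ≤ Real.sqrt (4 * (t ^ 3 - t)) := Real.sqrt_le_sqrt (by nlinarith)
        _ = 2 * Real.sqrt (t ^ 3 - t) := by rw [Real.sqrt_mul (by norm_num), h4]

/-! ### The two lemniscate representations (non-vacuity of LemniscateTwoIsogeny, stmt-5382) -/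

/-- `[{x³ − x > 0}, a/√(x³ − x)]` is a genuine `KZ.IntegralRep 1` (literal shape of the crux at
`(A, B) = (−1, 0)`). [cite: KontsevichZagier2001, §1.1] -/
theorem exists_rep_lemniscate (a : ℚ) : ∃ r : KZ.IntegralRep 1,
    r.domain = {x : Fin 1 → ℝ | 0 < x 0 ^ 3 + ((-1 : ℤ) : ℝ) * x 0 + ((0 : ℤ) : ℝ)} ∧
    r.integrand = fun x => (a : ℝ) / Real.sqrt (x 0 ^ 3 + ((-1 : ℤ) : ℝ) * x 0 + ((0 : ℤ) : ℝ)) := by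
  have hmp := MeasureTheory.volume_preserving_funUnique (Fin 1) ℝ
  have hset : {x : Fin 1 → ℝ | 0 < x 0 ^ 3 + ((-1 : ℤ) : ℝ) * x 0 + ((0 : ℤ) : ℝ)} =
      (MeasurableEquiv.funUnique (Fin 1) ℝ) ⁻¹' (Ioo (-1 : ℝ) 0 ∪ Ioi 1) := by
    ext x
    simp only [Int.reduceNeg, Int.cast_neg, Int.cast_one, neg_mul, one_mul, Int.cast_zero, add_zero,
      mem_setOf_eq, mem_preimage]
    rw [← sub_eq_add_neg, cube_sub_self_pos_iff]
    simp [MeasurableEquiv.funUnique, Fin.default_eq_zero]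
  have hint : IntegrableOn (fun x : Fin 1 → ℝ => (a : ℝ) / Real.sqrt (x 0 ^ 3 + ((-1 : ℤ) : ℝ) * x 0 + ((0 : ℤ) : ℝ)))
      {x : Fin 1 → ℝ | 0 < x 0 ^ 3 + ((-1 : ℤ) : ℝ) * x 0 + ((0 : ℤ) : ℝ)} := by
    rw [hset]
    have h := (hmp.integrableOn_comp_preimage (MeasurableEquiv.measurableEmbedding _)).mpr
      (integrableOn_inv_sqrt_cube_sub_self.const_mul (a : ℝ))
    refine IntegrableOn.congr_fun h (fun x _ => ?_)
      ((measurableSet_Ioo.union measurableSet_Ioi).preimage (MeasurableEquiv.measurable _))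
    simp [MeasurableEquiv.funUnique, Fin.default_eq_zero, div_eq_mul_inv, sub_eq_add_neg]
  exact ⟨{ domain := _, integrand := _,
           isSemialgebraic_domain := isSemialgebraic_setOf_cubic_pos (-1) 0,
           isSemialgebraicFunOn_integrand := isSemialgebraicFunOn_integrand (-1) 0 a,
           integrableOn := hint }, rfl, rfl⟩

/-- `[{x³ + 4x > 0}, a/√(x³ + 4x)]` is a genuine `KZ.IntegralRep 1` (literal shape at
`(A, B) = (4, 0)`). [cite: KontsevichZagier2001, §1.1] -/
theorem exists_rep_four (a : ℚ) : ∃ r : KZ.IntegralRep 1,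
    r.domain = {x : Fin 1 → ℝ | 0 < x 0 ^ 3 + ((4 : ℤ) : ℝ) * x 0 + ((0 : ℤ) : ℝ)} ∧
    r.integrand = fun x => (a : ℝ) / Real.sqrt (x 0 ^ 3 + ((4 : ℤ) : ℝ) * x 0 + ((0 : ℤ) : ℝ)) := by
  have hmp := MeasureTheory.volume_preserving_funUnique (Fin 1) ℝ
  have hset : {x : Fin 1 → ℝ | 0 < x 0 ^ 3 + ((4 : ℤ) : ℝ) * x 0 + ((0 : ℤ) : ℝ)} =
      (MeasurableEquiv.funUnique (Fin 1) ℝ) ⁻¹' Ioi 0 := by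
    ext x
    simp only [Int.cast_ofNat, Int.cast_zero, add_zero, mem_setOf_eq, mem_preimage, mem_Ioi]
    rw [cube_add_four_mul_pos_iff]
    simp [MeasurableEquiv.funUnique, Fin.default_eq_zero]
  have hint : IntegrableOn (fun x : Fin 1 → ℝ => (a : ℝ) / Real.sqrt (x 0 ^ 3 + ((4 : ℤ) : ℝ) * x 0 + ((0 : ℤ) : ℝ)))
      {x : Fin 1 → ℝ | 0 < x 0 ^ 3 + ((4 : ℤ) : ℝ) * x 0 + ((0 : ℤ) : ℝ)} := by
    rw [hset]
    have h := (hmp.integrableOn_comp_preimage (MeasurableEquiv.measurableEmbedding _)).mpr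
      (integrableOn_inv_sqrt_cube_add_four_mul.const_mul (a : ℝ))
    refine IntegrableOn.congr_fun h (fun x _ => ?_) (measurableSet_Ioi.preimage (MeasurableEquiv.measurable _))
    simp [MeasurableEquiv.funUnique, Fin.default_eq_zero, div_eq_mul_inv]
  exact ⟨{ domain := _, integrand := _,
           isSemialgebraic_domain := isSemialgebraic_setOf_cubic_pos 4 0,
           isSemialgebraicFunOn_integrand := isSemialgebraicFunOn_integrand 4 0 a,
           integrableOn := hint }, rfl, rfl⟩


end Summit.KontsevichZagierPeriods.IsogenyCertificates.XMapPeriodTransferValue
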